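import Mathlib
import HarnessLib
import Summits.ValiantsHypothesis.ValiantsHypothesis.Theorems.MonotoneRestorationMonotoneRestorationQPLinearWidthDefs
import Literature.Combinatorics.SimpleGraph.ChordalTreeDecomposition

/-!
# Route MonotoneRestoration, crux `MonotoneRestorationQP` (stmt-15886), line `linear-width` — `HomIndist` IS STABLE UNDER
# INVARIANT SHIFTS AND SCALINGS; glued base points reduce to the diagonal (helper, def-free)

Basic API for the line's weighted indistinguishability `HomIndist n k` (`…LinearWidthDefs.lean`), needed by the glued kill
format (`…OrbitRestorationQPGluedKill.lean`, p827438) and the multiplier no-go (`…LinearWidthMultiplierNoGo.lean`, p827520):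

* `eval_homPoly_add_const` — SUB-PATTERN EXPANSION: `hom_E(A + β·J) = Σ_{E = T + T'} β^{|T'|} · hom_T(A)` (sum over the
  antidiagonal of the edge multiset; `T` keeps the vertex sets, so isolated vertices are retained);
* `eval_homPoly_const_mul` — HOMOGENEITY: `hom_E(t·A) = t^{|E|} · hom_E(A)`;
* `patternGraph_mono`, `treewidth_patternGraph_mono` — sub-patterns have no larger treewidth (`treewidth_mono`);
* `homIndist_add_const`, `homIndist_const_mul`, `homIndist_affine` — **`HomIndist n k A B` implies
  `HomIndist n k (t·A + β·J) (t·B + β·J)`** for all scalars `t, β`;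
* `homIndist_glued_iff_diagonal` — consequently indistinguishability of the GLUED points `α·I + β·(J − I) + N₁`,
  `α·I + β·(J − I) + N₂` is equivalent to that of the purely DIAGONAL gluings `(α − β)·I + N₁`, `(α − β)·I + N₂`: the only new
  ingredient a weighted Dvořák theorem for glued points needs is the marked diagonal (pattern-vertex identifications = minors
  of the pattern graph), recorded as the next lemma of the census (W-Dvořák-glued, size L).

Honest label: bookkeeping API; nothing closed; VP ≠ VNP untouched. [folklore; cite: DwivediPagoSeppelt2026, Def. 3.2]
-/

-- `Summit.ValiantsHypothesis.ValiantsHypothesis.…` is the tree's mandated namespace (Sub = Summit).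
set_option linter.dupNamespace false

noncomputable section

open scoped Classical

namespace Summit.ValiantsHypothesis.ValiantsHypothesis.Theorems

namespace HomIndistShift

open MvPolynomial Finset
open Literature.Computability.AlgebraicComplexity
open MonotoneRestorationQPLinearWidth

variable {n : ℕ}

/-- Evaluation of a homomorphism polynomial: `hom_E(A) = Σ_h Π_{e ∈ E} A(h e)`. [folklore] -/
theorem eval_homPoly {a b : ℕ} (E : Multiset (Fin a × Fin b)) (A : Fin n × Fin n → ℂ) :
    eval A (homPoly E n ℂ) =
      ∑ h : (Fin a → Fin n) × (Fin b → Fin n), (E.map fun e => A (h.1 e.1, h.2 e.2)).prod := by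
  unfold homPoly
  rw [map_sum]
  refine sum_congr rfl fun h _ => ?_
  rw [map_multiset_prod, Multiset.map_map]
  simp only [Function.comp_def, eval_X]

/-- **SUB-PATTERN EXPANSION**: `hom_E(A + β·J) = Σ_{(T,T') ∈ antidiagonal E} β^{|T'|} · hom_T(A)`. [folklore] -/
theorem eval_homPoly_add_const {a b : ℕ} (E : Multiset (Fin a × Fin b)) (A : Fin n × Fin n → ℂ) (β : ℂ) :
    eval (fun x => A x + β) (homPoly E n ℂ) =
      ((Multiset.antidiagonal E).map fun p => β ^ Multiset.card p.2 * eval A (homPoly p.1 n ℂ)).sum := by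
  rw [eval_homPoly]
  have hexp : ∀ h : (Fin a → Fin n) × (Fin b → Fin n),
      (E.map fun e => A (h.1 e.1, h.2 e.2) + β).prod =
        ((Multiset.antidiagonal E).map fun p =>
          (p.1.map fun e => A (h.1 e.1, h.2 e.2)).prod * β ^ Multiset.card p.2).sum := by
    intro h
    rw [Multiset.prod_map_add]
    refine congrArg _ (Multiset.map_congr rfl fun p _ => ?_)
    rw [Multiset.map_const', Multiset.prod_replicate]
  simp only [hexp]
  rw [Finset.sum_eq_multiset_sum, Multiset.sum_map_sum_map]
  refine congrArg _ (Multiset.map_congr rfl fun p _ => ?_)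
  rw [eval_homPoly, Finset.mul_sum, Finset.sum_eq_multiset_sum]
  refine congrArg _ (Multiset.map_congr rfl fun h _ => ?_)
  ring

/-- **HOMOGENEITY**: `hom_E(t·A) = t^{|E|} · hom_E(A)`. [folklore] -/
theorem eval_homPoly_const_mul {a b : ℕ} (E : Multiset (Fin a × Fin b)) (A : Fin n × Fin n → ℂ) (t : ℂ) :
    eval (fun x => t * A x) (homPoly E n ℂ) = t ^ Multiset.card E * eval A (homPoly E n ℂ) := by
  rw [eval_homPoly, eval_homPoly, Finset.mul_sum]
  refine sum_congr rfl fun h _ => ?_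
  rw [Multiset.prod_map_mul, Multiset.map_const', Multiset.prod_replicate]

/-- Sub-patterns give subgraphs: `T ≤ E → patternGraph T ≤ patternGraph E`. [folklore] -/
theorem patternGraph_mono {a b : ℕ} {T E : Multiset (Fin a × Fin b)} (h : T ≤ E) :
    patternGraph T ≤ patternGraph E := by
  intro u v huv
  rw [patternGraph, SimpleGraph.fromRel_adj] at huv ⊢
  refine ⟨huv.1, ?_⟩
  rcases huv.2 with ⟨p, hp, hu, hv⟩ | ⟨p, hp, hu, hv⟩
  · exact Or.inl ⟨p, Multiset.mem_of_le h hp, hu, hv⟩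
  · exact Or.inr ⟨p, Multiset.mem_of_le h hp, hu, hv⟩

/-- Sub-patterns have no larger treewidth. [folklore] -/
theorem treewidth_patternGraph_mono {a b : ℕ} {T E : Multiset (Fin a × Fin b)} (h : T ≤ E) :
    Literature.Combinatorics.SimpleGraph.treewidth (patternGraph T) ≤
      Literature.Combinatorics.SimpleGraph.treewidth (patternGraph E) :=
  Literature.Combinatorics.SimpleGraph.treewidth_mono (patternGraph_mono h)

/-- **`HomIndist` is stable under adding a constant to every entry** (`A ↦ A + β·J`). [folklore] -/
theorem homIndist_add_const {k : ℕ} {A B : Fin n × Fin n → ℂ} (h : HomIndist n k A B) (β : ℂ) :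
    HomIndist n k (fun x => A x + β) (fun x => B x + β) := by
  intro a b E htw
  rw [eval_homPoly_add_const, eval_homPoly_add_const]
  refine congrArg _ (Multiset.map_congr rfl fun p hp => ?_)
  have hle : p.1 ≤ E := by
    rw [Multiset.mem_antidiagonal] at hp
    rw [← hp]
    exact Multiset.le_add_right _ _
  rw [h a b p.1 ((treewidth_patternGraph_mono hle).trans_lt htw)]

/-- **`HomIndist` is stable under scaling every entry** (`A ↦ t·A`). [folklore] -/
theorem homIndist_const_mul {k : ℕ} {A B : Fin n × Fin n → ℂ} (h : HomIndist n k A B) (t : ℂ) :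
    HomIndist n k (fun x => t * A x) (fun x => t * B x) := by
  intro a b E htw
  rw [eval_homPoly_const_mul, eval_homPoly_const_mul, h a b E htw]

/-- `HomIndist` is stable under invariant affine maps `A ↦ t·A + β·J`. [folklore] -/
theorem homIndist_affine {k : ℕ} {A B : Fin n × Fin n → ℂ} (h : HomIndist n k A B) (t β : ℂ) :
    HomIndist n k (fun x => t * A x + β) (fun x => t * B x + β) :=
  homIndist_add_const (homIndist_const_mul h t) β

/-- **GLUED BASE POINTS REDUCE TO THE DIAGONAL**: for the `Sym_n`-fixed base point `a = α·I + β·(J − I)`, the glued points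
`a + N₁`, `a + N₂` are `HomIndist n k`-related iff the purely diagonal gluings `(α − β)·I + N₁`, `(α − β)·I + N₂` are.
[folklore] -/
theorem homIndist_glued_iff_diagonal {k : ℕ} (α β : ℂ) (N₁ N₂ : Fin n × Fin n → ℂ) :
    HomIndist n k (fun ij => (if ij.1 = ij.2 then α else β) + N₁ ij) (fun ij => (if ij.1 = ij.2 then α else β) + N₂ ij) ↔
      HomIndist n k (fun ij => (if ij.1 = ij.2 then α - β else 0) + N₁ ij)
        (fun ij => (if ij.1 = ij.2 then α - β else 0) + N₂ ij) := by
  constructor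
  · intro h
    have h' := homIndist_add_const h (-β)
    convert h' using 2 <;> split_ifs <;> ring
  · intro h
    have h' := homIndist_add_const h β
    convert h' using 2 <;> split_ifs <;> ring

end HomIndistShift

end Summit.ValiantsHypothesis.ValiantsHypothesis.Theorems

end
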